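import Mathlib
import Summits.NavierStokesRegularity.NavierStokesRegularity.Theorems.EulerZoomLiouvillePowerGaugeEulerLiouvilleEnergySaturationOwnRate
import Summits.NavierStokesRegularity.NavierStokesRegularity.Theorems.EulerZoomLiouvillePowerGaugeEulerLiouvilleEnergySaturationScaleODE
import Summits.NavierStokesRegularity.NavierStokesRegularity.Theorems.EulerZoomLiouvillePowerGaugeEulerLiouvilleSelfSimilarSeparablePast
import HarnessLib

/-!
# THE OWN-RATE UPPER ENERGY LAW for the residual power clocks `g ∈ [2/5, ½]`: a past/shifted collapse of rate `g` carries at most its OWN-RATE energy,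
# `∫_{B_L}|W|² ≤ C_δ L^{5 − 2/g + δ}` for every `δ > 0` — strictly below the class bound `L^{1−2ρ}` whenever `g < 1/(2+ρ)` (weak class, no profile hypothesis)
# (crux `EulerZoomLiouville.PowerGaugeEulerLiouville` = stmt-NavierStokesRegularity-19832; line `logtime-breathers`, residue T4 `stub_powerClockRest`)

Route `EulerZoomLiouville` (NavierStokesRegularity); width seat ns-ezl-w6 (cell ns-regularity-ideate, LEAD ns-typeII-p2).  Companion (PORTRAIT) of
`…SelfSimilarOwnRateSubExtremalPast` (the census dichotomy «vanish or saturate the own rate» for the residue window `g ∈ [2/5, 1/(2+ρ)]` of skeleton v53).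
The bootstrap FROM THE LEFT alone (`EnergySaturation.ownRate_leftStep`, no sub-extremality) descends the energy exponent of the profile from the class value
`1 − 2ρ` to the own-rate floor `5 − 2/g` up to any `δ > 0`:

* `EnergySaturation.ownRate_iterate_floor` — pure real: from `J ≤ C₀R^{1−2ρ}` to `J ≤ C R^{5−2/g+δ}` on `[L₁,∞)` (rate `2/5 ≤ g`, any `δ > 0`);
* `EnergySaturation.ballEnergy_le_ownRate_rpow` — profile level: class-`ρ` data (A₁)(E₁)(D₁) + Poisson + the rate-`g` local energy equality (`2/5 ≤ g`)
  ⇒ `∀ δ > 0, ∃ C L₁, ∀ L ≥ L₁, ∫_{B_L}|V|² ≤ C L^{5−2/g+δ}`;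
* `SlowClock.profile_energy_le_ownRate_past` — member level: a past/shifted power clock of rate `g ∈ [2/5, ½]` in the class has a velocity profile with
  `∫_{B_L}‖W‖² ≤ C_δ L^{5−2/g+δ}` for all large `L`.

So in the residue window the two-sided picture is: `≤ C_δ L^{5−2/g+δ}` always (this file), and `≥ c₁ L^{5−2/g}` along all large `L` unless the member is
trivial (`…OwnRateSubExtremalPast`).  WHAT THIS IS NOT: not NS, not E — a portrait of the power-clock residue of the crux CLASS 19832 on the MODEL lattice;
`--supports` stmt-19832; 19832 OPEN. [folklore; cf. BronziShvydkoy2015 Thm 1.1]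
-/

noncomputable section

-- flat `Theorems/<Route><Decl>…` files of one crux share the namespace of the crux (tree convention: `Summit.<S>.<S>.…`)
set_option linter.dupNamespace false

open MeasureTheory Set Filter Topology Metric Function TopologicalSpace
open scoped ENNReal NNReal RealInnerProductSpace ContDiff Laplacian

namespace Summit.NavierStokesRegularity.NavierStokesRegularity.Theorems.PowerGaugeEulerLiouville

open Literature.Analysis Literature.Analysis.FunctionSpaces Literature.Analysis.FluidPDE

namespace EnergySaturation

section Iterate

variable {ρ g : ℝ} {c : ℝ≥0} {A : ℝ} {J F : ℝ → ℝ}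

/-- **ITERATION TO THE OWN-RATE FLOOR** (pure real; `c > 0`, `2/5 ≤ g`, any `δ > 0`): from `J(R) ≤ C₀ R^{1−2ρ}` on `[1,∞)` (`C₀ ≤ 3c`) the step from the
left reaches `J(R) ≤ C R^{(5 − 2/g) + δ}` on some `[L₁,∞)` (while the exponent exceeds the floor, each step loses at least `5ρ/4`). [folklore] -/
theorem ownRate_iterate_floor (hρ : 0 < ρ) (hg0 : 0 < g) (hκ0 : 2 / g - 5 ≤ 0) {δ : ℝ} (hδ : 0 < δ) (hc : 0 < (c : ℝ))
    (hA0 : 0 ≤ A) (hJ0 : ∀ R : ℝ, 0 < R → 0 ≤ J R)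
    (hflux : ∀ S : ℝ, 0 ≤ S → S ≤ 3 * c → ∀ L : ℝ, 1 ≤ L →
      (∀ R : ℝ, L ≤ R → J R ≤ R ^ (1 - 2 * ρ) * S) →
      ∀ r : ℝ, L ≤ r → |(2 + ρ) * r ^ (2 * ρ - 2) * F r| ≤ A * S ^ (1 / 2 : ℝ) * r ^ (-1 - (2 + ρ) / 4))
    (hderiv : ∀ r : ℝ, 0 < r →
      HasDerivAt (fun L : ℝ => L ^ (2 / g - 5) * J L) (g⁻¹ * r ^ (2 / g - 6) * F r) r)
    {C₀ : ℝ} (hC₀ : 0 ≤ C₀) (hC₀3 : C₀ ≤ 3 * c)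
    (hbase : ∀ R : ℝ, 1 ≤ R → J R ≤ C₀ * R ^ (1 - 2 * ρ)) :
    ∃ C L₁ : ℝ, 0 ≤ C ∧ 1 ≤ L₁ ∧ ∀ R : ℝ, L₁ ≤ R → J R ≤ C * R ^ (-(2 / g - 5) + δ) := by
  set t : ℝ := -(2 / g - 5) + δ with ht
  have ht0 : 0 < t := by rw [ht]; linarith
  -- trivial case: the target exponent is above the class exponent
  by_cases htop : 1 - 2 * ρ ≤ t
  · refine ⟨C₀, 1, hC₀, le_rfl, fun R hR => (hbase R hR).trans ?_⟩
    exact mul_le_mul_of_nonneg_left (Real.rpow_le_rpow_of_exponent_le hR htop) hC₀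
  push Not at htop
  set d : ℝ := 5 * ρ / 4 with hd
  have hd0 : 0 < d := by rw [hd]; positivity
  -- invariant: either the floor is reached, or an admissible bound with `m ≤ 1 − 2ρ − k d`
  have hQ : ∀ k : ℕ, ∃ m C L₁ : ℝ, 0 ≤ C ∧ 1 ≤ L₁ ∧ (∀ R : ℝ, L₁ ≤ R → J R ≤ C * R ^ m) ∧
      (m = t ∨ (m ≤ 1 - 2 * ρ - k * d ∧ m ≤ 1 - 2 * ρ ∧
        ∀ r : ℝ, L₁ ≤ r → C * r ^ (m - (1 - 2 * ρ)) ≤ 3 * c)) := by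
    intro k
    induction k with
    | zero =>
      refine ⟨1 - 2 * ρ, C₀, 1, hC₀, le_rfl, hbase, Or.inr ⟨by simp, le_rfl, fun r hr => ?_⟩⟩
      rw [sub_self, Real.rpow_zero, mul_one]
      exact hC₀3
    | succ k ih =>
      obtain ⟨m, C, L₁, hC, hL₁, hb, hcase⟩ := ih
      rcases hcase with hfl | ⟨hmk, hm, h3c⟩
      · exact ⟨m, C, L₁, hC, hL₁, hb, Or.inl hfl⟩
      obtain ⟨C', hC'0, hb'⟩ := ownRate_leftStep hρ hg0 hδ hA0 hJ0 hflux hderiv hm hC hL₁ hb h3c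
      by_cases hμ : m / 2 - 5 * ρ / 4 ≤ t
      · -- the floor is reached
        have hmax : max (m / 2 - 5 * ρ / 4) (-(2 / g - 5) + δ) = t := by rw [ht]; exact max_eq_right hμ
        refine ⟨t, C', L₁, hC'0, hL₁, fun R hR => ?_, Or.inl rfl⟩
        have := hb' R hR; rwa [hmax] at this
      · push Not at hμ
        have hmax : max (m / 2 - 5 * ρ / 4) (-(2 / g - 5) + δ) = m / 2 - 5 * ρ / 4 := by
          rw [ht] at hμ; exact max_eq_left hμ.le
        set mp : ℝ := m / 2 - 5 * ρ / 4 with hmp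
        have hmp_lt : mp < m := by rw [hmp]; linarith
        have hmp_k : mp ≤ 1 - 2 * ρ - (↑(k + 1) : ℝ) * d := by
          rw [hmp, hd]; push_cast; rw [hd] at hmk; linarith
        have hmp_le : mp ≤ 1 - 2 * ρ := by linarith
        have hexp : mp - (1 - 2 * ρ) < 0 := by linarith
        have htend : Tendsto (fun r : ℝ => C' * r ^ (mp - (1 - 2 * ρ))) atTop (𝓝 (C' * 0)) := by
          refine tendsto_const_nhds.mul ?_
          have := tendsto_rpow_neg_atTop (y := -(mp - (1 - 2 * ρ))) (by linarith)
          simpa using this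
        rw [mul_zero] at htend
        have h3c0 : (0 : ℝ) < 3 * c := by positivity
        obtain ⟨L₂, hL₂δ, hL₂ge⟩ :=
          ((htend.eventually (gt_mem_nhds h3c0)).and (eventually_ge_atTop L₁)).exists
        have hL₂1 : 1 ≤ L₂ := hL₁.trans hL₂ge
        have hL₂0 : 0 < L₂ := lt_of_lt_of_le one_pos hL₂1
        refine ⟨mp, C', L₂, hC'0, hL₂1, fun R hR => ?_, Or.inr ⟨hmp_k, hmp_le, fun r hr => ?_⟩⟩
        · have := hb' R (hL₂ge.trans hR); rwa [hmax] at this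
        · have hr0 : 0 < r := lt_of_lt_of_le hL₂0 hr
          have hmono : r ^ (mp - (1 - 2 * ρ)) ≤ L₂ ^ (mp - (1 - 2 * ρ)) :=
            Real.rpow_le_rpow_of_nonpos hL₂0 hr hexp.le
          calc C' * r ^ (mp - (1 - 2 * ρ)) ≤ C' * L₂ ^ (mp - (1 - 2 * ρ)) := mul_le_mul_of_nonneg_left hmono hC'0
            _ ≤ 3 * c := hL₂δ.le
  -- choose `k` with `1 − 2ρ − k d < 0 < t`: then the floor has been reached
  obtain ⟨k, hk⟩ := exists_nat_gt ((1 - 2 * ρ) / d)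
  obtain ⟨m, C, L₁, hC, hL₁, hb, hcase⟩ := hQ k
  rcases hcase with hfl | ⟨hmk, -, -⟩
  · exact ⟨C, L₁, hC, hL₁, fun R hR => by rw [← hfl]; exact hb R hR⟩
  · -- the exponent went below `0 < t`: the bound with exponent `m` is a bound with exponent `t`
    have hlt : (1 - 2 * ρ) < k * d := by rwa [div_lt_iff₀ hd0] at hk
    have hmt : m ≤ t := by linarith
    refine ⟨C, L₁, hC, hL₁, fun R hR => (hb R hR).trans ?_⟩
    exact mul_le_mul_of_nonneg_left (Real.rpow_le_rpow_of_exponent_le (hL₁.trans hR) hmt) hC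

end Iterate


variable {ρ g : ℝ}
  {V : EuclideanSpace ℝ (Fin 3) → EuclideanSpace ℝ (Fin 3)} {P : EuclideanSpace ℝ (Fin 3) → ℝ}
  {G : EuclideanSpace ℝ (Fin 3) → EuclideanSpace ℝ (Fin 3) →L[ℝ] EuclideanSpace ℝ (Fin 3)}

/-- **THE OWN-RATE UPPER ENERGY LAW (profile level).**  `(V, P, G)` with the thresholded class data (A₁), (E₁), (D₁) of DATA exponent `0 < ρ < 1`, the weak
Poisson equation and the profile local energy EQUALITY of a collapse of rate `g ≥ 2/5` (literal shape): for every `δ > 0` there are `C ≥ 0` and `L₁ ≥ 1`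
with `∫_{B_L}|V|² ≤ C L^{(5 − 2/g) + δ}` for all `L ≥ L₁`. [folklore; cf. BronziShvydkoy2015 Thm 1.1] -/
theorem ballEnergy_le_ownRate_rpow (hρ : 0 < ρ) (hρ1 : ρ < 1) (hg0 : 0 < g) (hκ0 : 2 / g - 5 ≤ 0) {δ : ℝ} (hδ : 0 < δ)
    (hVm : AEStronglyMeasurable V volume) (hPm : AEStronglyMeasurable P volume)
    (hGm : AEStronglyMeasurable G volume)
    (hVG : HasWeakFDerivOn (⊤ : Opens (EuclideanSpace ℝ (Fin 3))) volume V G) {c : ℝ≥0}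
    (hA : ∀ L : ℝ, 1 ≤ L → ∫⁻ y in ball (0 : EuclideanSpace ℝ (Fin 3)) L, ‖V y‖ₑ ^ 2 ≤
      (c : ℝ≥0∞) * ENNReal.ofReal (L ^ (1 - 2 * ρ)))
    (hE : ∀ L : ℝ, 1 ≤ L →
      ∫⁻ y in ball (0 : EuclideanSpace ℝ (Fin 3)) L, ENNReal.ofReal (frobeniusNormSq (G y)) ≤
        ENNReal.ofReal (L ^ (1 - ρ)) * (ENNReal.ofReal ((1 - ρ) / (2 + ρ)) * (c : ℝ≥0∞)))
    (hD : ∀ L : ℝ, 1 ≤ L →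
      ∫⁻ y in ball (0 : EuclideanSpace ℝ (Fin 3)) L, ‖P y‖ₑ ^ (3 / 2 : ℝ) ≤
        ENNReal.ofReal (L ^ (2 - 2 * ρ)) * (ENNReal.ofReal ((2 - 2 * ρ) / (2 + ρ)) * (c : ℝ≥0∞)))
    (hPoisson : ∀ θ : EuclideanSpace ℝ (Fin 3) → ℝ, ContDiff ℝ (⊤ : ℕ∞) θ → HasCompactSupport θ →
      ∫ y, P y * (Δ θ) y = -∫ y, fderiv ℝ (fderiv ℝ θ) y (V y) (V y))
    (hEE : ∀ θ : EuclideanSpace ℝ (Fin 3) → ℝ, IsTestFunctionOn (⊤ : Opens (EuclideanSpace ℝ (Fin 3))) θ →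
      (2 - 5 * g) * ∫ x, θ x * ‖V x‖ ^ 2 =
        (∫ x, (‖V x‖ ^ 2 + 2 * P x) * ⟪V x, gradient θ x⟫) +
          g * ∫ x, ‖V x‖ ^ 2 * ⟪x, gradient θ x⟫) :
    ∃ C L₁ : ℝ, 0 ≤ C ∧ 1 ≤ L₁ ∧ ∀ L : ℝ, L₁ ≤ L →
      ∫⁻ y in ball (0 : EuclideanSpace ℝ (Fin 3)) L, ‖V y‖ₑ ^ 2 ≤ ENNReal.ofReal (C * L ^ (-(2 / g - 5) + δ)) := by
  have hc0 : (0 : ℝ) ≤ c := c.2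
  have hV2 : LocallyIntegrable (fun y => ‖V y‖ ^ 2) volume := locallyIntegrable_norm_sq_of_growth_loc hVm hA
  obtain ⟨σ, hσs, hσc, h0, h1, hone, hzero, -⟩ := exists_radialCutoff
  have hσ : IsTestFunctionOn (⊤ : Opens (EuclideanSpace ℝ (Fin 3))) σ := ⟨hσs, hσc, fun _ _ => trivial⟩
  set J : ℝ → ℝ := fun R => ∫ y, σ (R⁻¹ • y) * ‖V y‖ ^ 2 with hJ
  set F : ℝ → ℝ := fun r => ∫ x, (‖V x‖ ^ 2 + 2 * P x) * ⟪V x, gradient (fun z => σ (r⁻¹ • z)) x⟫ with hF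
  have hJ0 : ∀ R : ℝ, 0 < R → 0 ≤ J R := fun R _ =>
    integral_nonneg fun y => mul_nonneg (h0 _) (sq_nonneg _)
  -- a power bound on `J` with the own-rate exponent
  have hpowb : ∃ C L₁ : ℝ, 0 ≤ C ∧ 1 ≤ L₁ ∧ ∀ R : ℝ, L₁ ≤ R → J R ≤ C * R ^ (-(2 / g - 5) + δ) := by
    by_cases hc : (c : ℝ) = 0
    · refine ⟨0, 1, le_rfl, le_rfl, fun R hR => ?_⟩
      have hR0 : 0 < R := lt_of_lt_of_le one_pos hR
      have h := normEnergy_le_of_growth_loc (ρ := ρ) h0 h1 hzero hVm hA hR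
      rw [hc, mul_zero] at h
      have hRp : 0 < R ^ (2 * ρ - 1) := Real.rpow_pos_of_pos hR0 _
      have hJle : J R ≤ 0 := by
        have : R ^ (2 * ρ - 1) * J R ≤ R ^ (2 * ρ - 1) * 0 := by rw [mul_zero]; exact h
        exact le_of_mul_le_mul_left this hRp
      simpa using hJle
    have hcpos : 0 < (c : ℝ) := lt_of_le_of_ne hc0 (Ne.symm hc)
    have hEEσ : ∀ L : ℝ, 0 < L → (2 - 5 * g) * ∫ x, σ (L⁻¹ • x) * ‖V x‖ ^ 2 =
        (∫ x, (‖V x‖ ^ 2 + 2 * P x) * ⟪V x, gradient (fun z => σ (L⁻¹ • z)) x⟫) +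
          g * ∫ x, ‖V x‖ ^ 2 * ⟪x, gradient (fun z => σ (L⁻¹ • z)) x⟫ :=
      fun L hL => hEE _ (isTestFunctionOn_comp_inv_smul hσ hL.ne')
    have hderiv : ∀ r : ℝ, 0 < r →
        HasDerivAt (fun L : ℝ => L ^ (2 / g - 5) * J L) (g⁻¹ * r ^ (2 / g - 6) * F r) r :=
      fun r hr => hasDerivAt_rpowMul_cutoffEnergy_of_energyEquality hg0.ne' hσ hVm hV2 hr (hEEσ r hr)
    obtain ⟨A, hA0, hfluxW⟩ := exists_fluxWeight_le_of_sup_loc hρ hρ1 hσ h0 h1 hone hzero hVm hPm hGm hVG hA hE hD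
      hPoisson
    have hflux : ∀ S : ℝ, 0 ≤ S → S ≤ 3 * c → ∀ L : ℝ, 1 ≤ L →
        (∀ R : ℝ, L ≤ R → J R ≤ R ^ (1 - 2 * ρ) * S) →
        ∀ r : ℝ, L ≤ r → |(2 + ρ) * r ^ (2 * ρ - 2) * F r| ≤ A * S ^ (1 / 2 : ℝ) * r ^ (-1 - (2 + ρ) / 4) :=
      fun S hS hS3 L hL hsup r hr => hfluxW S hS hS3 L hL hsup r hr
    set C₀ : ℝ := (3 : ℝ) ^ (1 - 2 * ρ) * c with hC₀
    have hC₀0 : 0 ≤ C₀ := by rw [hC₀]; positivity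
    have hC₀3 : C₀ ≤ 3 * c := by
      have h3 : (3 : ℝ) ^ (1 - 2 * ρ) ≤ 3 := by
        conv_rhs => rw [← Real.rpow_one 3]
        exact Real.rpow_le_rpow_of_exponent_le (by norm_num) (by linarith)
      rw [hC₀]; gcongr
    have hbase : ∀ R : ℝ, 1 ≤ R → J R ≤ C₀ * R ^ (1 - 2 * ρ) := by
      intro R hR
      have hR0 : 0 < R := lt_of_lt_of_le one_pos hR
      have h := normEnergy_le_of_growth_loc (ρ := ρ) h0 h1 hzero hVm hA hR
      have hRR : R ^ (1 - 2 * ρ) * R ^ (2 * ρ - 1) = 1 := by rw [← Real.rpow_add hR0]; norm_num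
      calc J R = R ^ (1 - 2 * ρ) * (R ^ (2 * ρ - 1) * J R) := by rw [← mul_assoc, hRR, one_mul]
        _ ≤ R ^ (1 - 2 * ρ) * ((3 : ℝ) ^ (1 - 2 * ρ) * c) :=
            mul_le_mul_of_nonneg_left h (Real.rpow_nonneg hR0.le _)
        _ = C₀ * R ^ (1 - 2 * ρ) := by rw [hC₀]; ring
    exact ownRate_iterate_floor hρ hg0 hκ0 hδ hcpos hA0 hJ0 hflux hderiv hC₀0 hC₀3 hbase
  obtain ⟨C, L₁, hC, hL₁, hb⟩ := hpowb
  refine ⟨C, L₁, hC, hL₁, fun L hL => ?_⟩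
  have hL0 : 0 < L := lt_of_lt_of_le (lt_of_lt_of_le one_pos hL₁) hL
  exact (lintegral_ball_sq_le_cutoffEnergy hσs.continuous hσc h0 hone hV2 hL0).trans (ENNReal.ofReal_le_ofReal (hb L hL))

end EnergySaturation

namespace SlowClock

variable {ρ g T T₁ : ℝ} {x₀ : EuclideanSpace ℝ (Fin 3)}
  {u : ℝ → EuclideanSpace ℝ (Fin 3) → EuclideanSpace ℝ (Fin 3)} {p : ℝ → EuclideanSpace ℝ (Fin 3) → ℝ}
  {H : ℝ → EuclideanSpace ℝ (Fin 3) → EuclideanSpace ℝ (Fin 3) →L[ℝ] EuclideanSpace ℝ (Fin 3)} {c : ℝ≥0}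
  {W : EuclideanSpace ℝ (Fin 3) → EuclideanSpace ℝ (Fin 3)} {P : EuclideanSpace ℝ (Fin 3) → ℝ}

/-- **THE OWN-RATE UPPER ENERGY LAW (member level).**  Crux hypotheses verbatim (`0 < ρ ≤ ½`, weak class) + exact self-similarity of `(u, p)` about `(T, x₀)`
at a rate `g ∈ [2/5, ½]` FOR `τ < T₁` ONLY (`T₁ ≤ 0`, `T₁ ≤ T`): for every `δ > 0` the velocity profile obeys `∫_{B_L}‖W‖² ≤ C L^{(5 − 2/g) + δ}` for all large
`L` — at most its OWN-RATE energy, strictly below the class growth `L^{1−2ρ}` whenever `g < 1/(2+ρ)`. [folklore; cf. BronziShvydkoy2015 Thm 1.1] -/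
theorem profile_energy_le_ownRate_past (hρ : 0 < ρ) (hρh : ρ ≤ 1 / 2) (hT₁ : T₁ ≤ 0) (hTT₁ : T₁ ≤ T)
    (x₀ : EuclideanSpace ℝ (Fin 3))
    (hsw : IsSuitableWeakSolutionOn (slab (EuclideanSpace ℝ (Fin 3)) (Iio 0) isOpen_Iio) 0 0 u p)
    (hH : HasWeakSpatialGradientOn (slab (EuclideanSpace ℝ (Fin 3)) (Iio 0) isOpen_Iio) u H)
    (hgauge : ∀ a : ℝ, 0 < a →
      ENNReal.ofReal (a ^ (2 * ρ)) * cknA a (0 : ℝ × EuclideanSpace ℝ (Fin 3)) u +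
          ENNReal.ofReal (a ^ ρ) * cknE a (0 : ℝ × EuclideanSpace ℝ (Fin 3)) H +
        ENNReal.ofReal (a ^ (2 * ρ)) * cknD a (0 : ℝ × EuclideanSpace ℝ (Fin 3)) p ≤ (c : ℝ≥0∞))
    (hg25 : 2 / 5 ≤ g) (hg2 : 2 * g ≤ 1)
    (hu : ∀ τ : ℝ, τ < T₁ → u τ = fun x => selfSimilarCollapse g T W τ (x - x₀))
    (hp : ∀ τ : ℝ, τ < T₁ → p τ = fun x => selfSimilarCollapsePressure g T P τ (x - x₀))
    {δ : ℝ} (hδ : 0 < δ) :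
    ∃ C L₁ : ℝ, 0 ≤ C ∧ 1 ≤ L₁ ∧ ∀ L : ℝ, L₁ ≤ L →
      ∫⁻ y in ball (0 : EuclideanSpace ℝ (Fin 3)) L, ‖W y‖ₑ ^ 2 ≤ ENNReal.ofReal (C * L ^ (-(2 / g - 5) + δ)) := by
  have hρ1 : ρ < 1 := by linarith
  have hg0 : 0 < g := by linarith
  have hκ0 : 2 / g - 5 ≤ 0 := by
    rw [sub_nonpos, div_le_iff₀ hg0]; linarith
  obtain ⟨G, c', hWm, hPm, hGm, hWG, hA₁, hE₁, hD₁, hPoisson, hEE⟩ :=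
    exists_locData_past_rate hρ hρh hT₁ hTT₁ x₀ hsw hH hgauge hg0.le hg2 hu hp
  exact EnergySaturation.ballEnergy_le_ownRate_rpow hρ hρ1 hg0 hκ0 hδ hWm hPm hGm hWG hA₁ hE₁ hD₁ hPoisson hEE

end SlowClock

end Summit.NavierStokesRegularity.NavierStokesRegularity.Theorems.PowerGaugeEulerLiouville

end
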